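import Literature.Analysis.Complex.SimilarityPrincipleLocal
import Literature.Geometry.Symplectic.LeafCoordinateComplexLinearisation
import Summits.SmoothPoincare4.SmoothPoincare4.Theorems.SymplecticOrigamiGromovRecognitionRelEndHelperLinearisedNormalFrame
import Summits.SmoothPoincare4.SmoothPoincare4.Theorems.SymplecticOrigamiGromovRecognitionRelEndHelperLinearisedDbarBound

/-!
# Zeros of the normal velocity of a linearised `J`-holomorphic field: the flat local dichotomy
(registered helper `helper_linearisedNormalDichotomyFlat` of line `cross-cap-laurent`, crux
`GromovRecognitionRelEnd`, item stmt-SmoothPoincare4-11009; third brick of the flat proof of the child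
stub `stub_normalVelocityDichotomy` of the split piece `LocalFoliationEmbeddedSpheres`, item
stmt-SmoothPoincare4-16778)

Flat model, dimension four.  `b : ℂ → F` a smooth immersed `J`-holomorphic curve near `0`
(`J(b z)² = -1` along it), `ξ : ℂ → F` a smooth solution of the LINEARISED Cauchy–Riemann equation
along `b` (hypothesis `hlin`; the tangential fields `z ↦ db_z w` are solutions too, hypothesis `htan`),
and `ψ : F → ℂ` a LEAF FUNCTION for `b` (smooth near `b 0`, `ψ ∘ b ≡ 0`, `dψ_{b 0}` onto).  The normal
velocity of `ξ` read through `ψ` is `σ z = dψ_{b z} (ξ z)`.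

Claim (`helper_linearisedNormalDichotomyFlat`; Wendl 2018, proof of Prop. 2.53 with §2.4–2.5 /
Hofer–Lizan–Sikorav 1997: "sections in `ker D_u^N` have only positive isolated zeros"): if `σ 0 = 0`
then EITHER `σ ≡ 0` near `0`, OR `0` is an isolated zero of `σ` whose winding number on every small
circle is non-zero, of a sign `s = ±1` which is the ORIENTATION SIGN of `dψ_{b 0}` relative to `J(b 0)`
(`0 < s · Im (dψ (J V) · conj (dψ V))` for every `V ∉ ker dψ_{b 0}`).

Proof.  Let `P_z, Q_z` be the tangential/normal coordinates of the sheet-chart frame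
(`helper_linearisedNormalFrame`) and `σ̃ z = P_z (ξ z)` the COMPLEX normal coordinate.  By
`helper_linearisedDbarBound`, `‖∂̄ σ̃‖ ≤ M ‖σ̃‖` near `0`; and `σ z = L_z (σ̃ z)` with the real-linear
`L_z β = dψ_{b z} (Re β • ν₀ + Im β • J(b z) ν₀)` (`dψ_{b z} ∘ db_z = d(ψ ∘ b)_z = 0`), where `L_0` is
invertible (`ker dψ_{b 0} = db_0(ℂ)` by a dimension count, and the frame is injective).  So `σ̃ 0 = 0`,
and the local similarity principle (`similarity_local_dichotomy`) gives the dichotomy for `σ̃` with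
POSITIVE indices.  Back to `σ`: zeros correspond (all `L_z` are injective near `0`), and on a small
circle `wind σ = wind (L_0 ∘ σ̃)` (Rouché, `L_z → L_0`) `= sign(det L_0) · wind σ̃` (a real-linear
automorphism `x ↦ α x + β x̄` of `ℂ` multiplies winding numbers by the sign of `|α|² - |β|²`,
`wind_mul_add_mul_conj_of_norm_lt`), and `det L_0 = Im (L_0 i · conj (L_0 1)) = Im (dψ (J ν₀) · conj (dψ ν₀))`
has the orientation sign, the same for all `V ∉ ker dψ` (`im_mul_conj_pos_iff`).

References: C. Wendl, *Holomorphic Curves in Low Dimensions*, LNM 2216 (2018), Prop. 2.53 and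
§2.4–2.5; H. Hofer, V. Lizan, J.-C. Sikorav, *On genericity for holomorphic curves in four-dimensional
almost-complex manifolds*, J. Geom. Anal. 7 (1997), Thm. 1 / §3.  No new definitions, notation or
instances.
-/

noncomputable section

open scoped ContDiff Topology ComplexConjugate
open Set Function Filter Metric Complex
open Literature.Analysis.Complex Literature.Topology.PlaneTopology Literature.Geometry.Symplectic

-- the prescribed namespace `Summit.<P>.<Sub>.…` duplicates `SmoothPoincare4` (P = Sub)
set_option linter.dupNamespace false

namespace Summit.SmoothPoincare4.SmoothPoincare4.Theorems.GromovRecognitionRelEnd.CrossCapLaurent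

namespace LinearisedDichotomy

/-! ### Real-linear maps of `ℂ`: the `α x + β x̄` form, the determinant, winding numbers -/

/-- **Every real-linear map `L : ℂ → ℂ` is `x ↦ α x + β x̄`** with `α = ½ (L 1 - i L i)`,
`β = ½ (L 1 + i L i)`. [folklore] -/
theorem realLinear_eq_mul_add_mul_conj (L : ℂ →L[ℝ] ℂ) (x : ℂ) :
    L x = (2⁻¹ * (L 1 - I * L I)) * x + (2⁻¹ * (L 1 + I * L I)) * conj x := by
  have hx : x = x.re • (1 : ℂ) + x.im • I := by
    rw [real_smul, real_smul, mul_one]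
    exact (re_add_im x).symm
  conv_lhs => rw [hx]
  rw [map_add, map_smul, map_smul, real_smul, real_smul]
  have hconj : conj x = (x.re : ℂ) - (x.im : ℂ) * I := by
    conv_lhs => rw [(re_add_im x).symm]
    simp only [map_add, map_mul, conj_ofReal, conj_I]
    ring
  have hx' : x = (x.re : ℂ) + (x.im : ℂ) * I := (re_add_im x).symm
  rw [hconj]
  conv_rhs => arg 1; rw [hx']
  linear_combination ((x.im : ℂ) * L I) * I_sq

/-- **The determinant of `x ↦ α x + β x̄` is `|α|² - |β|²`, and for the map `L` it is
`Im (L i · conj (L 1))`.** [folklore] -/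
theorem normSq_sub_normSq_eq_im (L : ℂ →L[ℝ] ℂ) :
    ‖2⁻¹ * (L 1 - I * L I)‖ ^ 2 - ‖2⁻¹ * (L 1 + I * L I)‖ ^ 2 = (L I * conj (L 1)).im := by
  rw [← normSq_eq_norm_sq, ← normSq_eq_norm_sq]
  set u : ℂ := L 1 with hu
  set v : ℂ := L I with hv
  simp only [normSq_apply, mul_re, mul_im, inv_re, inv_im, sub_re, sub_im, add_re, add_im, I_re,
    I_im, conj_re, conj_im, re_ofNat, im_ofNat]
  ring

/-- **A real-linear AUTOMORPHISM of `ℂ` multiplies winding numbers by the sign of its determinant**: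
for an injective `L` and a non-vanishing loop `f`, `wind (L ∘ f) = wind f` if
`Im (L i · conj (L 1)) > 0` and `= - wind f` if `< 0`. [folklore] -/
theorem wind_comp_realLinear (L : ℂ →L[ℝ] ℂ) {f : ℝ → ℂ} (hf : IsNonvanishingLoop f) :
    (0 < (L I * conj (L 1)).im → wind (fun t => L (f t)) = wind f) ∧
    ((L I * conj (L 1)).im < 0 → wind (fun t => L (f t)) = -wind f) := by
  have hrepr : (fun t => L (f t)) =
      fun t => (2⁻¹ * (L 1 - I * L I)) * f t + (2⁻¹ * (L 1 + I * L I)) * conj (f t) :=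
    funext fun t => realLinear_eq_mul_add_mul_conj L (f t)
  have hdet := normSq_sub_normSq_eq_im L
  constructor
  · intro hpos
    rw [hrepr]
    apply wind_mul_add_mul_conj_of_norm_lt hf
    have h : ‖2⁻¹ * (L 1 + I * L I)‖ ^ 2 < ‖2⁻¹ * (L 1 - I * L I)‖ ^ 2 := by linarith
    exact lt_of_pow_lt_pow_left₀ 2 (norm_nonneg _) h
  · intro hneg
    rw [hrepr]
    apply wind_mul_add_mul_conj_of_norm_lt' hf
    have h : ‖2⁻¹ * (L 1 - I * L I)‖ ^ 2 < ‖2⁻¹ * (L 1 + I * L I)‖ ^ 2 := by linarith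
    exact lt_of_pow_lt_pow_left₀ 2 (norm_nonneg _) h

/-- An injective real-linear map of `ℂ` is bounded below: `c ‖x‖ ≤ ‖L x‖` with `c > 0`. [folklore] -/
theorem exists_bound_below_of_injective (L : ℂ →L[ℝ] ℂ) (hL : Injective L) :
    ∃ c : ℝ, 0 < c ∧ ∀ x : ℂ, c * ‖x‖ ≤ ‖L x‖ := by
  have hbij : Bijective (L : ℂ →ₗ[ℝ] ℂ) :=
    ⟨hL, (LinearMap.injective_iff_surjective (f := (L : ℂ →ₗ[ℝ] ℂ))).1 hL⟩
  set e : ℂ ≃L[ℝ] ℂ := (LinearEquiv.ofBijective (L : ℂ →ₗ[ℝ] ℂ) hbij).toContinuousLinearEquiv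
    with he
  have hecoe : ∀ x, e x = L x := fun _ => rfl
  set K : ℝ := ‖(e.symm : ℂ →L[ℝ] ℂ)‖ with hK
  have hK0 : 0 ≤ K := norm_nonneg _
  refine ⟨(K + 1)⁻¹, by positivity, fun x => ?_⟩
  have h1 : ‖x‖ ≤ K * ‖L x‖ := by
    have := (e.symm : ℂ →L[ℝ] ℂ).le_opNorm (e x)
    rw [ContinuousLinearEquiv.coe_coe, e.symm_apply_apply, hecoe] at this
    exact this
  rw [inv_mul_le_iff₀ (by positivity)]
  calc ‖x‖ ≤ K * ‖L x‖ := h1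
    _ ≤ (K + 1) * ‖L x‖ := by gcongr; linarith

/-! ### The kernel of a leaf function along an immersed curve -/

/-- **`ker dψ_{b 0} = db_0(ℂ)`** for a leaf function: `dψ ∘ db_0 = 0`, `db_0` injective, `dψ` onto `ℂ`
and `dim F = 4`. [folklore] -/
theorem ker_eq_range {F : Type*} [NormedAddCommGroup F] [NormedSpace ℝ F] [FiniteDimensional ℝ F]
    (h4 : Module.finrank ℝ F = 4) (D : ℂ →L[ℝ] F) (Λ : F →L[ℝ] ℂ) (hD : Injective D)
    (hΛ : Surjective Λ) (hcomp : ∀ w : ℂ, Λ (D w) = 0) :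
    LinearMap.ker (Λ : F →ₗ[ℝ] ℂ) = LinearMap.range (D : ℂ →ₗ[ℝ] F) := by
  symm
  apply Submodule.eq_of_le_of_finrank_eq
  · rintro _ ⟨w, rfl⟩
    exact hcomp w
  · have h1 : Module.finrank ℝ (LinearMap.range (D : ℂ →ₗ[ℝ] F)) = 2 := by
      rw [LinearMap.finrank_range_of_inj hD, finrank_real_complex]
    have h2 := LinearMap.finrank_range_add_finrank_ker (Λ : F →ₗ[ℝ] ℂ)
    rw [LinearMap.range_eq_top.2 hΛ, finrank_top, finrank_real_complex, h4] at h2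
    omega

end LinearisedDichotomy

open LinearisedDichotomy in
/-- **Registered helper `helper_linearisedNormalDichotomyFlat`: the normal velocity of a linearised
`J`-holomorphic field along an immersed `J`-curve, read through a leaf function, vanishes identically
near a zero or has an isolated zero of signed index there, the sign being the orientation sign of the
leaf function relative to `J`.** [cite: Wendl2018, Prop. 2.53 and §2.4–2.5] -/
theorem helper_linearisedNormalDichotomyFlat : ∀ (F : Type) [NormedAddCommGroup F] [NormedSpace ℝ F] [FiniteDimensional ℝ F], Module.finrank ℝ F = 4 → ∀ (J : F → F →L[ℝ] F) (b : ℂ → F) (ξ : ℂ → F) (ψ : F → ℂ) (T : Set F) (R : ℝ), ContDiff ℝ ∞ J → ContDiff ℝ ∞ b → 0 < R → Function.Injective (fderiv ℝ b 0) → (∀ z ∈ Metric.ball (0 : ℂ) R, ∀ α : ℂ, fderiv ℝ b z (Complex.I * α) = J (b z) (fderiv ℝ b z α)) → (∀ z ∈ Metric.ball (0 : ℂ) R, ∀ w : F, J (b z) (J (b z) w) = -w) → (∀ z ∈ Metric.ball (0 : ℂ) R, ∀ w ζ : ℂ, fderiv ℝ (fun z : ℂ => fderiv ℝ b z w) z (Complex.I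 * ζ) = J (b z) (fderiv ℝ (fun z : ℂ => fderiv ℝ b z w) z ζ) + (fderiv ℝ J (b z) (fderiv ℝ b z w)) (fderiv ℝ b z ζ)) → ContDiffOn ℝ ∞ ξ (Metric.ball 0 R) → (∀ z ∈ Metric.ball (0 : ℂ) R, ∀ ζ : ℂ, fderiv ℝ ξ z (Complex.I * ζ) = J (b z) (fderiv ℝ ξ z ζ) + (fderiv ℝ J (b z) (ξ z)) (fderiv ℝ b z ζ)) → IsOpen T → b 0 ∈ T → ContDiffOn ℝ ∞ ψ T → (∀ z ∈ Metric.ball (0 : ℂ) R, ψ (b z) = 0) → Function.Surjective (fderiv ℝ ψ (b 0)) → fderiv ℝ ψ (b 0) (ξ 0) = 0 → (∀ᶠ z in 𝓝 (0 : ℂ), fderiv ℝ ψ (b z) (ξ z) = 0) ∨ ∃ (s : ℤ) (r₀ : ℝ), (s = 1 ∨ s = -1) ∧ 0 < r₀ ∧ (∀ V : F, fderiv ℝ ψ (b 0) V ≠ 0 → 0 < (s : ℝ) * (fderiv ℝ ψ (b 0) (J (b 0) V) * (starRingEnd ℂ) (fderiv ℝ ψ (b 0) V)).im) ∧ (∀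 z : ℂ, 0 < ‖z‖ → ‖z‖ ≤ r₀ → fderiv ℝ ψ (b z) (ξ z) ≠ 0) ∧ (∀ r : ℝ, 0 < r → r ≤ r₀ → 0 < (s : ℤ) * Literature.Topology.PlaneTopology.wind (fun t : ℝ => fderiv ℝ ψ (b (Literature.Topology.PlaneTopology.circleLoop 0 r t)) (ξ (Literature.Topology.PlaneTopology.circleLoop 0 r t)))) := by
  intro F _ _ _ h4 J b ξ ψ T R hJ hb hR hinj hbJ hJ2 htan hξ hlin hT hbT hψ hψb hψsurj h0
  -- ### Step 0: the frame package and the `∂̄`-bound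
  have hbJev : ∀ᶠ z in 𝓝 (0 : ℂ), ∀ α : ℂ, fderiv ℝ b z (Complex.I * α) = J (b z) (fderiv ℝ b z α) := by
    filter_upwards [ball_mem_nhds (0 : ℂ) hR] with z hz using hbJ z hz
  have hJ2ev : ∀ᶠ z in 𝓝 (0 : ℂ), ∀ w : F, J (b z) (J (b z) w) = -w := by
    filter_upwards [ball_mem_nhds (0 : ℂ) hR] with z hz using hJ2 z hz
  obtain ⟨ν₀, ρ₁, P, Q, hρ₁, hPs, -, hpack⟩ :=
    helper_linearisedNormalFrame F h4 J b hJ hb hinj hbJev hJ2ev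
  -- a common radius, also keeping `b` inside `T`
  have hbTev : ∀ᶠ z in 𝓝 (0 : ℂ), b z ∈ T := hb.continuous.continuousAt.preimage_mem_nhds (hT.mem_nhds hbT)
  obtain ⟨ρ, hρ, hρR, hρ₁', hρT⟩ : ∃ ρ : ℝ, 0 < ρ ∧ ρ ≤ R ∧ ρ ≤ ρ₁ ∧ ∀ z ∈ ball (0 : ℂ) ρ, b z ∈ T := by
    obtain ⟨ρ₂, hρ₂, hρ₂T⟩ := Metric.eventually_nhds_iff_ball.1 hbTev
    refine ⟨min (min R ρ₁) ρ₂, lt_min (lt_min hR hρ₁) hρ₂, (min_le_left _ _).trans (min_le_left _ _),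
      (min_le_left _ _).trans (min_le_right _ _), fun z hz => hρ₂T z ?_⟩
    exact ball_subset_ball (min_le_right _ _) hz
  have hballR : ball (0 : ℂ) ρ ⊆ ball 0 R := ball_subset_ball hρR
  have hball₁ : ball (0 : ℂ) ρ ⊆ ball 0 ρ₁ := ball_subset_ball hρ₁'
  have hpackρ : ∀ z ∈ ball (0 : ℂ) ρ, (∀ v : F, v = fderiv ℝ b z (Q z v) +
      ((P z v).re • ν₀ + (P z v).im • J (b z) ν₀)) ∧ (∀ v : F, P z (J (b z) v) = Complex.I * P z v) ∧
      (∀ w : ℂ, P z (fderiv ℝ b z w) = 0) := fun z hz =>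
    ⟨(hpack z (hball₁ hz)).2.2.2.1, (hpack z (hball₁ hz)).2.2.2.2.2.2.1,
      (hpack z (hball₁ hz)).2.2.2.2.2.2.2⟩
  obtain ⟨ρ', M, hρ', h2ρ', -, hσs, hbound⟩ := helper_linearisedDbarBound F J b ν₀ ρ P Q ξ hJ hb hρ
    (hPs.mono hball₁) hpackρ (fun z hz => htan z (hballR hz)) (hξ.mono hballR)
    (fun z hz => hlin z (hballR hz))
  -- ### Step 1: `σ z = L z (σ̃ z)` on `ball 0 ρ`
  set σt : ℂ → ℂ := fun z => P z (ξ z) with hσt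
  set L : ℂ → ℂ →L[ℝ] ℂ := fun z => (fderiv ℝ ψ (b z)).comp
    (Complex.reCLM.smulRight ν₀ + Complex.imCLM.smulRight (J (b z) ν₀)) with hL_def
  have hLapply : ∀ z β, L z β = fderiv ℝ ψ (b z) (β.re • ν₀ + β.im • J (b z) ν₀) := fun z β => by
    simp only [hL_def, ContinuousLinearMap.coe_comp, comp_apply]
    rw [LinearisedDbar.normalFrame_apply]
  -- `dψ_{b z} ∘ db_z = 0` on the disc
  have hψd : ∀ z ∈ ball (0 : ℂ) ρ, DifferentiableAt ℝ ψ (b z) := fun z hz =>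
    (hψ.contDiffAt (hT.mem_nhds (hρT z hz))).differentiableAt (by simp)
  have hcomp0 : ∀ z ∈ ball (0 : ℂ) ρ, ∀ w : ℂ, fderiv ℝ ψ (b z) (fderiv ℝ b z w) = 0 := by
    intro z hz w
    have hchain : fderiv ℝ (fun y => ψ (b y)) z = (fderiv ℝ ψ (b z)).comp (fderiv ℝ b z) :=
      fderiv_comp z (hψd z hz) ((hb.differentiable (by simp)) z)
    have hzero : fderiv ℝ (fun y => ψ (b y)) z = 0 := by
      have hev : (fun y => ψ (b y)) =ᶠ[𝓝 z] fun _ => 0 := by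
        filter_upwards [isOpen_ball.mem_nhds hz] with y hy using hψb y (hballR hy)
      rw [hev.fderiv_eq]
      exact fderiv_const_apply 0
    have := congrArg (fun T : ℂ →L[ℝ] ℂ => T w) (hchain.symm.trans hzero)
    simpa using this
  have hσL : ∀ z ∈ ball (0 : ℂ) ρ, fderiv ℝ ψ (b z) (ξ z) = L z (σt z) := by
    intro z hz
    obtain ⟨hdec, -, -⟩ := hpackρ z hz
    conv_lhs => rw [hdec (ξ z)]
    rw [map_add, hcomp0 z hz, zero_add, hLapply]
  -- ### Step 2: `L 0` is injective, with a lower bound, and `L z → L 0`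
  have hframe0 := (hpack 0 (mem_ball_self hρ₁)).2.2.1
  have hL0inj : Injective (L 0) := by
    intro β₁ β₂ h
    rw [hLapply, hLapply] at h
    have hker : (β₁.re • ν₀ + β₁.im • J (b 0) ν₀) - (β₂.re • ν₀ + β₂.im • J (b 0) ν₀) ∈
        LinearMap.ker ((fderiv ℝ ψ (b 0) : F →L[ℝ] ℂ) : F →ₗ[ℝ] ℂ) := by
      rw [LinearMap.mem_ker, ContinuousLinearMap.coe_coe, map_sub, h, sub_self]
    rw [ker_eq_range h4 (fderiv ℝ b 0) (fderiv ℝ ψ (b 0)) hinj hψsurj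
      (hcomp0 0 (mem_ball_self hρ))] at hker
    obtain ⟨w, hw⟩ := hker
    -- `frame (w, 0) = frame (0, β₁ - β₂)`
    have hfr : sheetChartDeriv J b ν₀ 0 (w, 0) = sheetChartDeriv J b ν₀ 0 (0, β₁ - β₂) := by
      rw [sheetChartDeriv_apply, sheetChartDeriv_apply]
      simp only [zero_re, zero_smul, zero_im, add_zero, map_zero, zero_add, sub_re, sub_im]
      rw [ContinuousLinearMap.coe_coe] at hw
      rw [hw, sub_smul, sub_smul]
      abel
    have := hframe0 hfr
    simp only [Prod.mk.injEq] at this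
    exact sub_eq_zero.1 this.2.symm
  obtain ⟨c, hc, hcL⟩ := exists_bound_below_of_injective (L 0) hL0inj
  have hLc : ContinuousOn L (ball 0 ρ) := by
    have h1 : ContinuousOn (fun z => fderiv ℝ ψ (b z)) (ball 0 ρ) :=
      (hψ.continuousOn_fderiv_of_isOpen hT (by simp)).comp hb.continuous.continuousOn hρT
    have h2 : Continuous (fun z => Complex.reCLM.smulRight ν₀ + Complex.imCLM.smulRight (J (b z) ν₀)) := by
      have hv : ContDiff ℝ ∞ (fun z => J (b z) ν₀) := (hJ.comp hb).clm_apply contDiff_const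
      exact (contDiff_const.add (contDiff_const.smulRight hv)).continuous
    exact h1.clm_comp h2.continuousOn
  -- radius `r₁` with `‖L z - L 0‖ < c` for `‖z‖ ≤ r₁`
  obtain ⟨r₁, hr₁, hr₁ρ, hLnear⟩ : ∃ r₁ : ℝ, 0 < r₁ ∧ r₁ < ρ ∧ ∀ z : ℂ, ‖z‖ ≤ r₁ → ‖L z - L 0‖ < c := by
    have hca : ContinuousAt L 0 := hLc.continuousAt (ball_mem_nhds 0 hρ)
    have hev : ∀ᶠ z in 𝓝 (0 : ℂ), ‖L z - L 0‖ < c := by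
      have h1 : ContinuousAt (fun z => ‖L z - L 0‖) 0 :=
        (hca.sub (continuousAt_const (y := L 0))).norm
      have h0 : ‖L 0 - L 0‖ < c := by simpa using hc
      exact h1.eventually (gt_mem_nhds h0)
    obtain ⟨r, hr, hrb⟩ := Metric.eventually_nhds_iff_ball.1 hev
    refine ⟨min (r / 2) (ρ / 2), by positivity, (min_le_right _ _).trans_lt (by linarith), fun z hz => hrb z ?_⟩
    rw [mem_ball, dist_zero_right]
    exact hz.trans_lt ((min_le_left _ _).trans_lt (by linarith))
  -- all `L z`, `‖z‖ ≤ r₁`, are injective with the lower bound `(c - ‖L z - L 0‖) ‖β‖`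
  have hLlow : ∀ z : ℂ, ‖z‖ ≤ r₁ → ∀ β : ℂ, (c - ‖L z - L 0‖) * ‖β‖ ≤ ‖L z β‖ := by
    intro z hz β
    have h1 := hcL β
    have h2 : ‖(L z - L 0) β‖ ≤ ‖L z - L 0‖ * ‖β‖ := ContinuousLinearMap.le_opNorm _ _
    have h3 : ‖L 0 β‖ ≤ ‖L z β‖ + ‖(L z - L 0) β‖ := by
      have : L 0 β = L z β - (L z - L 0) β := by simp
      rw [this]
      exact norm_sub_le _ _
    nlinarith
  have hLzinj : ∀ z : ℂ, ‖z‖ ≤ r₁ → ∀ β : ℂ, L z β = 0 → β = 0 := by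
    intro z hz β hβ
    have h := hLlow z hz β
    rw [hβ, norm_zero] at h
    have hpos : 0 < c - ‖L z - L 0‖ := by linarith [hLnear z hz]
    by_contra hne
    have : 0 < (c - ‖L z - L 0‖) * ‖β‖ := mul_pos hpos (norm_pos_iff.2 hne)
    linarith
  have hr₁ball : ∀ z : ℂ, ‖z‖ ≤ r₁ → z ∈ ball (0 : ℂ) ρ := fun z hz => by
    rw [mem_ball, dist_zero_right]; exact hz.trans_lt hr₁ρ
  -- ### Step 3: `σ̃ 0 = 0` and the similarity principle
  have hσt0 : σt 0 = 0 := by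
    have h := hσL 0 (mem_ball_self hρ)
    rw [h0] at h
    exact hL0inj (by rw [← h, map_zero])
  rcases similarity_local_dichotomy σt 0 ρ' M hρ' hσs hbound hσt0 with hzero | ⟨ε, hε, hερ', hne, hwind⟩
  · -- ### Case A: `σ̃ ≡ 0` near `0`, hence `σ ≡ 0`
    left
    filter_upwards [hzero, ball_mem_nhds (0 : ℂ) hρ] with z hz hzρ
    rw [hσL z hzρ, hz, map_zero]
  -- ### Case B: isolated zero of `σ̃` with positive index
  right
  -- the sign
  set D : ℝ := (L 0 I * conj (L 0 1)).im with hD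
  have hL1 : L 0 1 = fderiv ℝ ψ (b 0) ν₀ := by rw [hLapply]; simp
  have hLI : L 0 I = fderiv ℝ ψ (b 0) (J (b 0) ν₀) := by rw [hLapply]; simp
  -- `ker dψ` is `J`-invariant (it is the complex tangent line)
  have hJ20 := hJ2 0 (mem_ball_self hR)
  have hkerJ : ∀ v : F, fderiv ℝ ψ (b 0) v = 0 → fderiv ℝ ψ (b 0) (J (b 0) v) = 0 := by
    intro v hv
    have hmem : v ∈ LinearMap.ker ((fderiv ℝ ψ (b 0) : F →L[ℝ] ℂ) : F →ₗ[ℝ] ℂ) := hv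
    rw [ker_eq_range h4 (fderiv ℝ b 0) (fderiv ℝ ψ (b 0)) hinj hψsurj
      (hcomp0 0 (mem_ball_self hρ))] at hmem
    obtain ⟨w, hw⟩ := hmem
    rw [ContinuousLinearMap.coe_coe] at hw
    rw [← hw, ← hbJ 0 (mem_ball_self hR) w]
    exact hcomp0 0 (mem_ball_self hρ) _
  have hν₀ne : fderiv ℝ ψ (b 0) ν₀ ≠ 0 := by
    rw [← hL1]
    intro h
    exact one_ne_zero (hL0inj (by rw [h, map_zero]))
  have hDne : D ≠ 0 := by
    rw [hD, hL1, hLI]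
    exact im_mul_conj_ne_zero ((J (b 0) : F →L[ℝ] F) : F →ₗ[ℝ] F)
      ((fderiv ℝ ψ (b 0) : F →L[ℝ] ℂ) : F →ₗ[ℝ] ℂ) hJ20 hkerJ hν₀ne
  set s : ℤ := if 0 < D then 1 else -1 with hs_def
  have hs1 : s = 1 ∨ s = -1 := by
    by_cases h : 0 < D <;> simp [hs_def, h]
  -- the radius
  set r₀ : ℝ := min ε r₁ with hr₀_def
  have hr₀ : 0 < r₀ := lt_min hε hr₁
  refine ⟨s, r₀, hs1, hr₀, ?_, ?_, ?_⟩
  · -- the orientation clause, for every `V ∉ ker dψ`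
    intro V hV
    have hiff := im_mul_conj_pos_iff ((J (b 0) : F →L[ℝ] F) : F →ₗ[ℝ] F)
      ((fderiv ℝ ψ (b 0) : F →L[ℝ] ℂ) : F →ₗ[ℝ] ℂ) hJ20 hkerJ hν₀ne hV
    have hVne := im_mul_conj_ne_zero ((J (b 0) : F →L[ℝ] F) : F →ₗ[ℝ] F)
      ((fderiv ℝ ψ (b 0) : F →L[ℝ] ℂ) : F →ₗ[ℝ] ℂ) hJ20 hkerJ hV
    simp only [ContinuousLinearMap.coe_coe] at hiff hVne
    have hDeq : D = (fderiv ℝ ψ (b 0) (J (b 0) ν₀) * conj (fderiv ℝ ψ (b 0) ν₀)).im := by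
      rw [hD, hL1, hLI]
    by_cases hDpos : 0 < D
    · have : s = 1 := by simp [hs_def, hDpos]
      rw [this, Int.cast_one, one_mul]
      exact hiff.1 (hDeq ▸ hDpos)
    · have : s = -1 := by simp [hs_def, hDpos]
      rw [this, Int.cast_neg, Int.cast_one, neg_mul, one_mul, neg_pos]
      rcases lt_or_gt_of_ne hVne with h | h
      · exact h
      · exact absurd (hDeq ▸ hiff.2 h) hDpos
  · -- zeros of `σ` in the punctured disc
    intro z hz0 hzr
    have hz1 : ‖z‖ ≤ r₁ := hzr.trans (min_le_right _ _)
    rw [hσL z (hr₁ball z hz1)]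
    intro h
    exact hne z (by simpa using hz0) (by simpa using hzr.trans (min_le_left _ _)) (hLzinj z hz1 _ h)
  · -- the winding numbers
    intro r hr hrr₀
    have hrε : r ≤ ε := hrr₀.trans (min_le_left _ _)
    have hr₁' : r ≤ r₁ := hrr₀.trans (min_le_right _ _)
    have hloop_norm : ∀ t, ‖circleLoop 0 r t‖ = r := fun t => by
      simpa [abs_of_pos hr] using norm_circleLoop_sub_center 0 r t
    -- the loop `σ̃ ∘ γ` is non-vanishing
    have hσtc : Continuous fun t => σt (circleLoop 0 r t) := by
      have h1 : ContinuousOn σt (ball 0 (2 * ρ')) := hσs.continuousOn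
      exact h1.comp_continuous (continuous_circleLoop 0 r) fun t => by
        rw [mem_ball, dist_zero_right, hloop_norm]; linarith
    have hnv : IsNonvanishingLoop fun t => σt (circleLoop 0 r t) :=
      ⟨hσtc.continuousOn, fun t _ => hne _ (by rw [sub_zero, hloop_norm]; exact hr)
        (by rw [sub_zero, hloop_norm]; exact hrε), by rw [circleLoop_zero_eq]⟩
    have hnvL : IsNonvanishingLoop fun t => L 0 (σt (circleLoop 0 r t)) :=
      ⟨(L 0).continuous.comp_continuousOn hσtc.continuousOn,
        fun t ht h => hnv.ne_zero t ht (hL0inj (by rw [h, map_zero])), by rw [circleLoop_zero_eq]⟩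
    -- Rouché: `wind σ = wind (L 0 ∘ σ̃)`
    have hrouche : wind (fun t => fderiv ℝ ψ (b (circleLoop 0 r t)) (ξ (circleLoop 0 r t))) =
        wind (fun t => L 0 (σt (circleLoop 0 r t))) := by
      have heq : (fun t => fderiv ℝ ψ (b (circleLoop 0 r t)) (ξ (circleLoop 0 r t))) =
          fun t => L (circleLoop 0 r t) (σt (circleLoop 0 r t)) :=
        funext fun t => hσL _ (hr₁ball _ (by rw [hloop_norm]; exact hr₁'))
      rw [heq]
      apply wind_eq_of_norm_sub_lt
      · have hL2 : ContinuousOn (fun t => L (circleLoop 0 r t)) (Icc 0 1) :=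
          hLc.comp_continuous (continuous_circleLoop 0 r) (fun t => hr₁ball _
            (by rw [hloop_norm]; exact hr₁')) |>.continuousOn
        exact hL2.clm_apply hσtc.continuousOn
      · rw [circleLoop_zero_eq]
      · exact hnvL
      · intro t ht
        set β := σt (circleLoop 0 r t) with hβ
        have hβne : β ≠ 0 := hnv.ne_zero t ht
        have hzt : ‖circleLoop 0 r t‖ ≤ r₁ := by rw [hloop_norm]; exact hr₁'
        have h1 : ‖L (circleLoop 0 r t) β - L 0 β‖ ≤ ‖L (circleLoop 0 r t) - L 0‖ * ‖β‖ := by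
          rw [← sub_apply]; exact ContinuousLinearMap.le_opNorm _ _
        have h2 : ‖L (circleLoop 0 r t) - L 0‖ * ‖β‖ < c * ‖β‖ :=
          mul_lt_mul_of_pos_right (hLnear _ hzt) (norm_pos_iff.2 hβne)
        exact lt_of_lt_of_le (lt_of_le_of_lt h1 h2) (hcL β)
    rw [hrouche]
    have hw := hwind r hr hrε
    obtain ⟨hposcase, hnegcase⟩ := wind_comp_realLinear (L 0) hnv
    by_cases hDpos : 0 < D
    · have : s = 1 := by simp [hs_def, hDpos]
      rw [this, one_mul, hposcase hDpos]
      exact hw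
    · have : s = -1 := by simp [hs_def, hDpos]
      have hDneg : D < 0 := lt_of_le_of_ne (not_lt.1 hDpos) hDne
      rw [this, hnegcase hDneg]
      linarith

end Summit.SmoothPoincare4.SmoothPoincare4.Theorems.GromovRecognitionRelEnd.CrossCapLaurent

end
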